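import Mathlib.GroupTheory.SpecificGroups.Cyclic.Basic
import Mathlib.Topology.Instances.ZMod
import Literature.AnabelianGeometry.AbsoluteAnabelian.AbsTopII.SemiEllipticTorsionFreeSeparation
import Literature.AnabelianGeometry.AbsoluteAnabelian.AbsTopII.SemiEllipticTransportTF
import HarnessLib

/-!
# [AbsTopII] Cor 3.3 (ii), print-faithful successor `Cor_3_3_iiTF`: a PRODUCER, for EVERY isogeny-level
# model, from the three printed non-anabelian inputs the corollary quotes — the covering determined by
# `J`, [AbsTopI] Lemma 4.1 (iv), Remark 3.1.1 (kernel proofs)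

S. Mochizuki, *Topics in Absolute Anabelian Geometry II: Decomposition Groups and Endomorphisms*
[AbsTopII] (bib `MochizukiAbsTopII2013`; kurims manuscript `paper:url-585b8d0ad0d9`, cell render
`HOME/lit/renders/AbsTopII-kurims-url-585b8d0ad0d9/p0068.txt` l.5–11), §3, Corollary 3.3 (ii) p. 68:
"The collection of open subgroups `Π_D ⊆ Π_C` that arise from finite étale double coverings `D → C`
that exhibit `C` as semi-elliptic [cf. Remark 3.1.1] may be characterized 'group-theoretically' as the
collection of open subgroups `J ⊆ Π_C` of index `2` such that `J ∩ Δ_C` [where `Δ_C := Ker(Π_C ↠ G')`]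
is torsion-free [i.e., the covering determined by `J` is a scheme — cf. [Mzk15], Lemma 4.1, (iv)]."
Proof, p. 69 l.1–4: "The assertions of Corollary 3.3 follow immediately from the definitions, together
with the various references quoted [...]".  The references quoted IN (ii): Remark 3.1.1 p. 65 ("`D_k̄ → C_k̄`
may be characterized as the unique [up to isomorphism over `C_k̄`] finite étale double covering of `C_k̄`
by a hyperbolic curve") and [AbsTopI] = [Mzk15] (bib `MochizukiAbsTopI2012`, kurims `paper:url-11ac98ba15fc`,
render `…/AbsTopI-kurims-url-11ac98ba15fc/p0045.txt`) Lemma 4.1 (iv) p. 45: "`X` is a hyperbolic curve if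
and only if `Δ` is torsion-free" (`Δ` over an algebraically closed field; here `Σ = Primes`).

PROOF-ONLY file (cell abc-iut, seat abc-iut-L4-t4 gens 13–14, self-row «COR33II-TF-PRINTED-PRODUCER»; no
`def`, no instance, no notation, no new named fact).  CONTEXT: the print-faithful successor `Cor_3_3_iiTF M`
(abc-iut-L4-t4, `SemiEllipticTorsionFree.lean`; "torsion-free" = no nontrivial element of finite order,
finding T1g11-F1) of abc-iut-L4-t6's `Cor_3_3_ii M` (FACT-LIST F-0234) is an unproved named fact over the
isogeny-level interface `IsogenyModel`; the tree holds MODEL producers only (abc-iut-L4-t4's abelian toy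
`exists_cor_3_3_iiTF_model`, abc-iut-L4-t10's geometric `F̂₂ ⊆ F̂₂ ⋊ {±1}` model
`exists_cor_3_3_iiTF_geometricModel`); the K4 census of node AbsTopII:Cor3.3(ii) records "producer at
genuine data NONE".  THIS FILE derives `Cor_3_3_iiTF M` for an ARBITRARY `M` from the three NON-anabelian
inputs print quotes, displayed as hypotheses in the model's vocabulary:
* `hcov` — "the covering determined by `J`" (p. 68; Galois correspondence for `Π_C = π₁(C)`, §0 p. 6): every
  open `J ⊆ Π_C` of index `2` is `Π_D` for a finite étale `D → C` — `∃ D (f : M.FinEt D C), M.arithImage f = J`;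
* `h41` — [AbsTopI] Lem 4.1 (iv) p. 45: `M.IsScheme X ↔ Δ_X` has no nontrivial element of finite order;
* `h311` — Rmk 3.1.1 p. 65 in the model's vocabulary (no `k̄`-base-change there): for a semi-elliptic `C`,
  every double covering `D → C` over `k` by a hyperbolic CURVE is a once-punctured elliptic curve.
Results (`namespace IsogenyModel`): `arithImage_inf_geom_eq_map_geom` (`Π_D ∩ Δ_C = φ(Δ_D)`),
`geom_torsionFree_iff_arithImage_inf_geom`, `isOver_of_index_two_of_not_geom_le` (`[Π_C : Π_D] = 2`,
`Δ_C ⊄ Π_D` ⇒ over `k`); the (⊆) half `ellipticDoubleCoverImages_subset_TF_of_lem41iv` from `h41` (⇒)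
alone; the (⊇) half `TF_subset_ellipticDoubleCoverImages_of_cov_lem41iv_rmk311` (`Δ_C ⊄ J` as `Δ_C` has
torsion and `J ∩ Δ_C` has not, so the covering is over `k`, of degree `2`, with `Δ_D ≅ J ∩ Δ_C`
torsion-free, a scheme, hence once-punctured elliptic); ★ `cor_3_3_iiTF_of_lem41iv_rmk311 : hcov → h41 →
h311 → Cor_3_3_iiTF M`; the node-closer form `image_ellipticDoubleCoverImages_eq_of_lem41iv_rmk311`
(`Cor_3_3_iiTF.image_doubleCovers_eq` by name); SEPARATION `not_cor_3_3_ii_and_cor_3_3_iiTF_of_lem41iv_rmk311`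
(same inputs + ONE genuine double covering whose `Π_D ∩ Δ_C` lacks unique roots ⇒ `¬ Cor_3_3_ii M ∧
Cor_3_3_iiTF M`, `cor_3_3_ii_false_of` by name); NON-VACUITY `exists_isogenyModel_cov_lem41iv_rmk311`
(finite toy `Π_D = 1 ↪ Π_C = ℤ/2` with identities: the inputs — `hcov` even for ALL open `J` — hold with
a semi-elliptic curve, and the producer fires there).

HONEST FRAMING: a CONDITIONAL producer over three displayed printed inputs, for OUR typing of Cor 3.3 (ii)
(special case `Π = π₁`, `Σ = Primes`); the inputs are statements about étale fundamental groups of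
hyperbolic orbicurves, not discharged here; conditional ≠ proved; typed ≠ proved; nothing here bears on
[IUTchIII] Cor 3.12 or asserts that abc is proved or refuted.  Axioms standard.
-/

namespace Literature.AnabelianGeometry.AbsoluteAnabelian.AbsTopII

open CategoryTheory Topology FundamentalExtension

universe u

/-! ### Transfer of "no nontrivial element of finite order" along injective homomorphisms -/

/-- An injective homomorphism `ψ` mapping `H` into `K` REFLECTS torsion-freeness: if `K` has no
nontrivial element of finite order, neither has `H` (the restriction `H → K` of `ψ` is injective and
preserves finite order). [folklore] -/
private theorem torsionFree_of_injective_of_mapsTo {A B : Type*} [Group A] [Group B] (ψ : A →* B)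
    (hψ : Function.Injective ψ) {H : Subgroup A} {K : Subgroup B} (hHK : ∀ x ∈ H, ψ x ∈ K)
    (hK : ∀ g : ↥K, IsOfFinOrder g → g = 1) : ∀ g : ↥H, IsOfFinOrder g → g = 1 := by
  -- the restriction `H → K` of `ψ`
  let ρ : ↥H →* ↥K := (ψ.comp H.subtype).codRestrict K fun h => hHK h h.2
  have hρ : Function.Injective ρ := by
    intro a b h
    have h' : ψ (a : A) = ψ (b : A) := congrArg Subtype.val h
    exact Subtype.ext (hψ h')
  intro g hg
  exact hρ ((hK (ρ g) (ρ.isOfFinOrder hg)).trans (map_one ρ).symm)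

/-- An injective homomorphism `ψ` with `K ⊆ ψ(H)` TRANSPORTS torsion-freeness: if `H` has no nontrivial
element of finite order, neither has `K` (an element `ψ x ∈ K` of finite order has `x` of finite order,
`ψ` being injective). [folklore] -/
private theorem torsionFree_of_injective_of_le_map {A B : Type*} [Group A] [Group B] (ψ : A →* B)
    (hψ : Function.Injective ψ) {H : Subgroup A} {K : Subgroup B} (hKH : K ≤ H.map ψ)
    (hH : ∀ g : ↥H, IsOfFinOrder g → g = 1) : ∀ g : ↥K, IsOfFinOrder g → g = 1 := by
  intro g hg
  obtain ⟨x, hxH, hx⟩ := Subgroup.mem_map.mp (hKH g.2)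
  have hg' : IsOfFinOrder (g : B) := K.subtype.isOfFinOrder hg
  have hx' : IsOfFinOrder x := by
    rw [← hψ.isOfFinOrder_iff, hx]
    exact hg'
  have h1 : (⟨x, hxH⟩ : ↥H) = 1 := hH ⟨x, hxH⟩ (H.subtype_injective.isOfFinOrder_iff.mp hx')
  have hx1 : x = 1 := congrArg Subtype.val h1
  apply Subtype.ext
  change (g : B) = 1
  rw [← hx, hx1, map_one]

/-! ### The homomorphism of extensions of a finite étale `D → C`: `Π_D ∩ Δ_C = φ(Δ_D)`; over `k` -/

namespace IsogenyModel

variable (M : IsogenyModel.{u})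

/-- The subgroup `Π_D ⊆ Π_C` of a finite étale `D → C` is OPEN (the induced homomorphism of extensions is
open injective, §0 p. 6). [cite: MochizukiAbsTopII2013, §0 p.6] -/
theorem isOpen_arithImage {D C : M.Curve} (f : M.FinEt D C) :
    IsOpen ((M.arithImage f : Subgroup (M.ext C).arith) : Set (M.ext C).arith) := by
  rw [IsogenyModel.arithImage, MonoidHom.coe_range]
  exact (M.extMap_isOpenInjective f).isOpen_range_arith

/-- Membership in `Π_D ⊆ Π_C`, unfolded. [cite: MochizukiAbsTopII2013, §0 p.6] -/
theorem mem_arithImage_iff {D C : M.Curve} (f : M.FinEt D C) (y : (M.ext C).arith) :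
    y ∈ M.arithImage f ↔ ∃ x : (M.ext D).arith, (M.extMap f).arith x = y :=
  Iff.rfl

/-- **`Π_D ∩ Δ_C = φ(Δ_D)`** for the homomorphism of extensions `φ` of a finite étale `D → C`: an element
`φ(x)` lies over `1 ∈ G_k` iff `x` lies over `1 ∈ G_{k_D}` (the square with the augmentations commutes
and `G_{k_D} → G_k` is injective). [cite: MochizukiAbsTopII2013, §0 p.6] -/
theorem arithImage_inf_geom_eq_map_geom {D C : M.Curve} (f : M.FinEt D C) :
    M.arithImage f ⊓ (M.ext C).geom = (M.ext D).geom.map (M.extMap f).arith.toMonoidHom := by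
  ext y
  rw [Subgroup.mem_inf, mem_arithImage_iff, Subgroup.mem_map, FundamentalExtension.mem_geom]
  constructor
  · rintro ⟨⟨x, rfl⟩, hy⟩
    refine ⟨x, ?_, rfl⟩
    rw [FundamentalExtension.mem_geom]
    rw [(M.extMap f).comm x] at hy
    exact (M.extMap_isOpenInjective f).gal_injective (hy.trans (map_one _).symm)
  · rintro ⟨x, hx, rfl⟩
    rw [FundamentalExtension.mem_geom] at hx
    refine ⟨⟨x, rfl⟩, ?_⟩
    change (M.ext C).aug ((M.extMap f).arith x) = 1
    rw [(M.extMap f).comm x, hx, map_one]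

/-- **`Δ_D` is torsion-free iff `Π_D ∩ Δ_C` is** (`φ` restricts to an isomorphism `Δ_D ⥲ Π_D ∩ Δ_C`) —
the identification behind print's gloss "[i.e., the covering determined by `J` is a scheme — cf.
[Mzk15], Lemma 4.1, (iv)]". [cite: MochizukiAbsTopII2013, Cor 3.3 (ii) p.68] -/
theorem geom_torsionFree_iff_arithImage_inf_geom {D C : M.Curve} (f : M.FinEt D C) :
    (∀ g : ↥(M.ext D).geom, IsOfFinOrder g → g = 1) ↔
      ∀ g : ↥(M.arithImage f ⊓ (M.ext C).geom), IsOfFinOrder g → g = 1 := by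
  have hinj : Function.Injective (M.extMap f).arith.toMonoidHom :=
    (M.extMap_isOpenInjective f).arith_injective
  constructor
  · intro hD
    exact torsionFree_of_injective_of_le_map _ hinj (M.arithImage_inf_geom_eq_map_geom f).le hD
  · intro hC
    refine torsionFree_of_injective_of_mapsTo _ hinj (fun x hx => ?_) hC
    rw [M.arithImage_inf_geom_eq_map_geom f]
    exact Subgroup.mem_map_of_mem _ hx

/-- **A finite étale `D → C` with `[Π_C : Π_D] = 2` and `Δ_C ⊄ Π_D` is OVER `k`** (`G_{k_D} ⥲ G_k`): every
`γ ∈ G_k` lifts to some `y ∈ Π_C`, and `y` or `y · a` (`a ∈ Δ_C ∖ Π_D`; index `2`) lies in `Π_D` over `γ`.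
[cite: MochizukiAbsTopII2013, §0 p.6] -/
theorem isOver_of_index_two_of_not_geom_le {D C : M.Curve} (f : M.FinEt D C)
    (hindex : (M.arithImage f).index = 2) (hnot : ¬ (M.ext C).geom ≤ M.arithImage f) :
    M.IsOver f := by
  refine ⟨(M.extMap_isOpenInjective f).gal_injective, fun γ => ?_⟩
  obtain ⟨a, haΔ, haJ⟩ := SetLike.not_le_iff_exists.mp hnot
  obtain ⟨y, hy⟩ := (M.ext C).aug_surjective γ
  -- some element of `Π_D ⊆ Π_C` lies over `γ`: `y` itself, or `y * a`
  have key : ∃ z ∈ M.arithImage f, (M.ext C).aug z = γ := by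
    by_cases hyJ : y ∈ M.arithImage f
    · exact ⟨y, hyJ, hy⟩
    · refine ⟨y * a, (Subgroup.mul_mem_iff_of_index_two hindex).mpr (iff_of_false hyJ haJ), ?_⟩
      rw [map_mul, hy, ((M.ext C).mem_geom).mp haΔ, mul_one]
  obtain ⟨z, ⟨x, rfl⟩, hz⟩ := key
  exact ⟨(M.ext D).aug x, ((M.extMap f).comm x).symm.trans hz⟩

/-! ### The producer -/

/-- **Cor 3.3 (ii), the (⊆) half, from [AbsTopI] Lemma 4.1 (iv) (⇒) alone**: `Π_D` of a double covering
`D → C` over `k` by a once-punctured elliptic curve is open, of index `2` (= the degree), and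
`Π_D ∩ Δ_C ≅ Δ_D` has no nontrivial element of finite order since the hyperbolic CURVE `D` has
torsion-free `Δ_D`. [cite: MochizukiAbsTopII2013, Cor 3.3 (ii) p.68] -/
theorem ellipticDoubleCoverImages_subset_TF_of_lem41iv
    (h41 : ∀ X : M.Curve, M.IsScheme X → ∀ g : ↥(M.ext X).geom, IsOfFinOrder g → g = 1)
    (C : M.Curve) :
    M.ellipticDoubleCoverImages C ⊆ semiEllipticDoubleCoverSubgroupsTF (M.ext C) := by
  rintro J ⟨D, f, -, ⟨hD, -, -⟩, hdeg, rfl⟩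
  exact ⟨M.isOpen_arithImage f, hdeg, (M.geom_torsionFree_iff_arithImage_inf_geom f).mp (h41 D hD)⟩

/-- **Cor 3.3 (ii), the (⊇) half, from the three printed inputs**: for a semi-elliptic `C` and an open
`J ⊆ Π_C` of index `2` with `J ∩ Δ_C` torsion-free, take the covering `D → C` determined by `J` (`hcov`);
`Δ_C ⊄ J` — otherwise `Δ_C` would be torsion-free and `C` a scheme ([AbsTopI] Lem 4.1 (iv) ⇐), whereas
`C` is semi-elliptic — so `D → C` is over `k`, of degree `[Π_C : J] = 2`; `Δ_D ≅ J ∩ Δ_C` is torsion-free,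
so `D` is a hyperbolic curve (Lem 4.1 (iv) ⇐: "[i.e., the covering determined by `J` is a scheme]"),
hence (Remark 3.1.1, `h311`) a once-punctured elliptic curve. [cite: MochizukiAbsTopII2013, Cor 3.3 (ii) p.68] -/
theorem TF_subset_ellipticDoubleCoverImages_of_cov_lem41iv_rmk311 {C : M.Curve}
    (hC : M.IsSemiElliptic C)
    (hcov : ∀ J : Subgroup (M.ext C).arith, IsOpen (J : Set (M.ext C).arith) → J.index = 2 →
      ∃ (D : M.Curve) (f : M.FinEt D C), M.arithImage f = J)
    (h41 : ∀ X : M.Curve, M.IsScheme X ↔ ∀ g : ↥(M.ext X).geom, IsOfFinOrder g → g = 1)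
    (h311 : ∀ (D : M.Curve) (f : M.FinEt D C), M.IsOver f → M.degree f = 2 → M.IsScheme D →
      M.IsOncePuncturedElliptic D) :
    semiEllipticDoubleCoverSubgroupsTF (M.ext C) ⊆ M.ellipticDoubleCoverImages C := by
  rintro J ⟨hopen, hindex, htf⟩
  -- the covering `D → C` determined by `J`
  obtain ⟨D, f, hf⟩ := hcov J hopen hindex
  subst hf
  -- `Δ_C ⊄ Π_D`: otherwise `Δ_C` would be torsion-free, i.e. `C` a scheme
  have hnot : ¬ (M.ext C).geom ≤ M.arithImage f := by
    intro hle
    refine hC.1 ((h41 C).mpr ?_)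
    exact torsionFree_of_injective_of_mapsTo (MonoidHom.id _) (fun _ _ h => h)
      (fun x hx => Subgroup.mem_inf.mpr ⟨hle hx, hx⟩) htf
  have hover : M.IsOver f := M.isOver_of_index_two_of_not_geom_le f hindex hnot
  have hscheme : M.IsScheme D :=
    (h41 D).mpr ((M.geom_torsionFree_iff_arithImage_inf_geom f).mpr htf)
  exact ⟨D, f, hover, h311 D f hover hindex hscheme, hindex, rfl⟩

/-- ★ **[AbsTopII] Corollary 3.3 (ii), print-faithful successor `Cor_3_3_iiTF`, PRODUCED for every
isogeny-level model from the three printed inputs the corollary quotes** — `hcov` "the covering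
determined by `J`" (Galois correspondence, for the index-`2` open subgroups), `h41` [AbsTopI] Lemma 4.1
(iv) ("`X` is a hyperbolic curve if and only if `Δ` is torsion-free"), `h311` Remark 3.1.1 (a double
covering of a semi-elliptic `C` over `k` by a hyperbolic curve is a once-punctured elliptic curve) —
"follow[s] immediately from the definitions, together with the various references quoted" (proof p. 69).
CONDITIONAL: the three inputs are displayed hypotheses, not discharged here.
[cite: MochizukiAbsTopII2013, Cor 3.3 (ii) p.68] -/
theorem cor_3_3_iiTF_of_lem41iv_rmk311
    (hcov : ∀ (C : M.Curve) (J : Subgroup (M.ext C).arith), IsOpen (J : Set (M.ext C).arith) →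
      J.index = 2 → ∃ (D : M.Curve) (f : M.FinEt D C), M.arithImage f = J)
    (h41 : ∀ X : M.Curve, M.IsScheme X ↔ ∀ g : ↥(M.ext X).geom, IsOfFinOrder g → g = 1)
    (h311 : ∀ C : M.Curve, M.IsSemiElliptic C → ∀ (D : M.Curve) (f : M.FinEt D C), M.IsOver f →
      M.degree f = 2 → M.IsScheme D → M.IsOncePuncturedElliptic D) :
    Literature.AnabelianGeometry.AbsoluteAnabelian.AbsTopII.Cor_3_3_iiTF M := fun C hC =>
  Set.Subset.antisymm
    (M.ellipticDoubleCoverImages_subset_TF_of_lem41iv (fun X hX => (h41 X).mp hX) C)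
    (M.TF_subset_ellipticDoubleCoverImages_of_cov_lem41iv_rmk311 hC (hcov C) h41 (h311 C hC))

/-- **The node-closer form** (the comparison version of Cor 3.3 (ii) used by Cor 3.4, proof p. 70 — the
cone node's closer `Cor_3_3_iiTF.image_doubleCovers_eq`), PRODUCED from the same three inputs: an
isomorphism `φ : Π_{C₁} ⥲ Π_{C₂}` with `φ(Δ_{C₁}) = Δ_{C₂}` between semi-elliptic `C₁, C₂` carries the
collection of `Π_D`'s of `C₁` bijectively onto that of `C₂`. [cite: MochizukiAbsTopII2013, Cor 3.4 p.70] -/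
theorem image_ellipticDoubleCoverImages_eq_of_lem41iv_rmk311
    (hcov : ∀ (C : M.Curve) (J : Subgroup (M.ext C).arith), IsOpen (J : Set (M.ext C).arith) →
      J.index = 2 → ∃ (D : M.Curve) (f : M.FinEt D C), M.arithImage f = J)
    (h41 : ∀ X : M.Curve, M.IsScheme X ↔ ∀ g : ↥(M.ext X).geom, IsOfFinOrder g → g = 1)
    (h311 : ∀ C : M.Curve, M.IsSemiElliptic C → ∀ (D : M.Curve) (f : M.FinEt D C), M.IsOver f →
      M.degree f = 2 → M.IsScheme D → M.IsOncePuncturedElliptic D)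
    {C₁ C₂ : M.Curve} (hC₁ : M.IsSemiElliptic C₁) (hC₂ : M.IsSemiElliptic C₂)
    (φ : (M.ext C₁).arith ≃ₜ* (M.ext C₂).arith)
    (hφ : (M.ext C₁).geom.map φ.toMulEquiv.toMonoidHom = (M.ext C₂).geom) :
    (fun J : Subgroup (M.ext C₁).arith => J.map φ.toMulEquiv.toMonoidHom) ''
        M.ellipticDoubleCoverImages C₁ = M.ellipticDoubleCoverImages C₂ :=
  (M.cor_3_3_iiTF_of_lem41iv_rmk311 hcov h41 h311).image_doubleCovers_eq hC₁ hC₂ φ hφ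

/-! ### Separation: print's inputs produce the successor, not the predecessor -/

/-- **SEPARATION inside Cor 3.3 (ii)**: at a model satisfying the three printed inputs and exhibiting ONE
genuine double covering whose `Π_D ∩ Δ_C` lacks unique roots (e.g. free pro-`Σ` of rank `2`,
`2, 3 ∈ Σ` — the `Δ_D` of a once-punctured elliptic curve: abc-iut-L4-t12's
`Summit.ABC.IUTFork.not_isMulTorsionFree_of_isFreeProOn`), the predecessor `Cor_3_3_ii M` (Mathlib
`IsMulTorsionFree` rendering) is FALSE while the successor `Cor_3_3_iiTF M` HOLDS.
[cite: MochizukiAbsTopII2013, Cor 3.3 (ii) p.68] -/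
theorem not_cor_3_3_ii_and_cor_3_3_iiTF_of_lem41iv_rmk311
    (hcov : ∀ (C : M.Curve) (J : Subgroup (M.ext C).arith), IsOpen (J : Set (M.ext C).arith) →
      J.index = 2 → ∃ (D : M.Curve) (f : M.FinEt D C), M.arithImage f = J)
    (h41 : ∀ X : M.Curve, M.IsScheme X ↔ ∀ g : ↥(M.ext X).geom, IsOfFinOrder g → g = 1)
    (h311 : ∀ C : M.Curve, M.IsSemiElliptic C → ∀ (D : M.Curve) (f : M.FinEt D C), M.IsOver f →
      M.degree f = 2 → M.IsScheme D → M.IsOncePuncturedElliptic D)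
    {C : M.Curve} (hC : M.IsSemiElliptic C) {J : Subgroup (M.ext C).arith}
    (hJ : J ∈ M.ellipticDoubleCoverImages C) (hnot : ¬ IsMulTorsionFree ↥(J ⊓ (M.ext C).geom)) :
    ¬ Literature.AnabelianGeometry.AbsoluteAnabelian.AbsTopII.Cor_3_3_ii M ∧
      Literature.AnabelianGeometry.AbsoluteAnabelian.AbsTopII.Cor_3_3_iiTF M :=
  ⟨cor_3_3_ii_false_of hC hJ hnot, M.cor_3_3_iiTF_of_lem41iv_rmk311 hcov h41 h311⟩

end IsogenyModel

/-! ### Non-vacuity: the three inputs hold jointly with a semi-elliptic curve (finite toy) -/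

/-- **The three printed inputs are JOINTLY SATISFIABLE together with a semi-elliptic curve, and the
producer FIRES there** (so it is not vacuous): the finite toy `Curve = Bool`, `Π_true = 1 ↪ Π_false = ℤ/2`
plus the two identities, trivial Galois groups, `IsScheme b := (b = true)`, type `(1, 1)` throughout.
There the Galois correspondence holds for EVERY open subgroup (the subgroups of `ℤ/2` are `1 = Π_true`
and `ℤ/2 = Π_false`), Lemma 4.1 (iv) holds (`Δ_true = 1` is torsion-free, `Δ_false = ℤ/2` is not),
Remark 3.1.1 holds (the only scheme is `true`, of type `(1, 1)`), `false` is semi-elliptic, and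
`Cor_3_3_iiTF` follows by `cor_3_3_iiTF_of_lem41iv_rmk311`.  Toy model; says nothing about hyperbolic
orbicurves. [cite: MochizukiAbsTopII2013, Cor 3.3 (ii) p.68] -/
theorem exists_isogenyModel_cov_lem41iv_rmk311 :
    ∃ M : IsogenyModel.{0},
      (∀ (C : M.Curve) (J : Subgroup (M.ext C).arith), IsOpen (J : Set (M.ext C).arith) →
          ∃ (D : M.Curve) (f : M.FinEt D C), M.arithImage f = J) ∧
      (∀ X : M.Curve, M.IsScheme X ↔ ∀ g : ↥(M.ext X).geom, IsOfFinOrder g → g = 1) ∧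
      (∀ C : M.Curve, M.IsSemiElliptic C → ∀ (D : M.Curve) (f : M.FinEt D C), M.IsOver f →
          M.degree f = 2 → M.IsScheme D → M.IsOncePuncturedElliptic D) ∧
      (∃ C : M.Curve, M.IsSemiElliptic C) ∧
      Literature.AnabelianGeometry.AbsoluteAnabelian.AbsTopII.Cor_3_3_iiTF M := by
  classical
  -- the groups `A = ℤ/2` (discrete) and `1`; the extensions `Π_D = 1 ↠ 1`, `Π_C = A ↠ 1`
  let A : Type := Multiplicative (ZMod 2)
  let G₁ : Type := PUnit.{1}
  let E₁ : FundamentalExtension.{0} :=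
    ⟨ProfiniteGrp.of G₁, ProfiniteGrp.of G₁, 1, fun _ => ⟨1, Subsingleton.elim _ _⟩⟩
  let E₂ : FundamentalExtension.{0} :=
    ⟨ProfiniteGrp.of A, ProfiniteGrp.of G₁, 1, fun _ => ⟨1, Subsingleton.elim _ _⟩⟩
  -- the morphism of extensions induced by `D → C`: the trivial inclusion on `Π`, identity on `G`
  let φ : E₁ ⟶ E₂ := ⟨1, ContinuousMonoidHom.id _, fun _ => Subsingleton.elim _ _⟩
  have hinj : Function.Injective φ.arith := fun _ _ _ => Subsingleton.elim _ _
  have hdisc₂ : DiscreteTopology E₂.arith := inferInstanceAs (DiscreteTopology A)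
  have hφ : φ.IsOpenInjective :=
    { arith_injective := hinj
      isOpen_range_arith := isOpen_discrete _
      gal_injective := fun _ _ _ => Subsingleton.elim _ _
      isOpen_range_gal := by
        rw [show Set.range φ.gal = Set.univ from Set.range_eq_univ.mpr fun x => ⟨x, rfl⟩]
        exact isOpen_univ }
  -- group-theoretic facts about `Π_true = 1` and `Π_false = ℤ/2`, stated before the model is built
  have hrange : φ.arith.toMonoidHom.range = ⊥ := by
    rw [eq_bot_iff]
    rintro x ⟨y, rfl⟩
    exact Subgroup.mem_bot.mpr rfl
  have hid₁ : (Hom.arith (𝟙 E₁)).toMonoidHom.range = ⊤ := MonoidHom.range_eq_top.mpr fun x => ⟨x, rfl⟩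
  have hid₂ : (Hom.arith (𝟙 E₂)).toMonoidHom.range = ⊤ := MonoidHom.range_eq_top.mpr fun x => ⟨x, rfl⟩
  have htop₁ : ∀ J : Subgroup E₁.arith, J = ⊤ := fun J =>
    eq_top_iff.mpr fun x _ => by
      rw [Subsingleton.elim x 1]
      exact J.one_mem
  have hcardA : Nat.card A = 2 := by simp [A, Nat.card_eq_fintype_card]
  have hsub₂ : ∀ J : Subgroup E₂.arith, J = ⊥ ∨ J = ⊤ := by
    intro J
    haveI : Fact (Nat.card E₂.arith).Prime := ⟨by rw [show Nat.card E₂.arith = 2 from hcardA]; decide⟩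
    exact J.eq_bot_or_eq_top_of_prime_card
  have hindex_bot : (⊥ : Subgroup E₂.arith).index = 2 := by rw [Subgroup.index_bot]; exact hcardA
  have htf₁ : ∀ g : ↥E₁.geom, IsOfFinOrder g → g = 1 := fun g _ =>
    Subtype.ext (Subsingleton.elim (g : E₁.arith) 1)
  have hgeom₂ : ∀ x : E₂.arith, x ∈ E₂.geom := fun x => Subsingleton.elim _ _
  have hntf₂ : ¬ ∀ g : ↥E₂.geom, IsOfFinOrder g → g = 1 := by
    intro h
    let g : A := Multiplicative.ofAdd (1 : ZMod 2)
    have hg1 : g ≠ 1 := by decide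
    have hg2 : g ^ 2 = 1 := by decide
    let y : ↥E₂.geom := ⟨g, hgeom₂ g⟩
    have hy2 : y ^ 2 = 1 := Subtype.ext hg2
    have hy : y = 1 := h y (isOfFinOrder_iff_pow_eq_one.mpr ⟨2, two_pos, hy2⟩)
    exact hg1 (congrArg Subtype.val hy)
  -- the model: `Curve = Bool`, finite étale morphisms `true → false` and the two identities
  let M : IsogenyModel.{0} :=
    { Curve := Bool
      ext := fun b => cond b E₁ E₂
      FinEt := fun Y X => PLift ((Y = true ∧ X = false) ∨ Y = X)
      extMap := fun {Y X} f =>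
        match Y, X, f with
        | true, false, _ => φ
        | true, true, _ => 𝟙 E₁
        | false, false, _ => 𝟙 E₂
        | false, true, ⟨h⟩ => absurd (h.elim And.left id) Bool.false_ne_true
      extMap_isOpenInjective := fun {Y X} f =>
        match Y, X, f with
        | true, false, _ => hφ
        | true, true, _ => Hom.IsOpenInjective.id E₁
        | false, false, _ => Hom.IsOpenInjective.id E₂
        | false, true, ⟨h⟩ => absurd (h.elim And.left id) Bool.false_ne_true
      IsScheme := fun b => b = true
      genus := fun _ => 1
      cuspCard := fun _ => 1
      IsDefinedOverNF := fun _ => True }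
  -- the double covering `D → C` of the model; its `Π_D ⊆ Π_C` is the trivial subgroup
  let f : M.FinEt true false := ⟨Or.inl ⟨rfl, rfl⟩⟩
  have hext : M.extMap f = φ := rfl
  have hJ : M.arithImage f = ⊥ := hrange
  have hdeg : M.degree f = 2 := by
    show (M.arithImage f).index = 2
    rw [hJ]; exact hindex_bot
  have hover : M.IsOver f := by
    show Function.Bijective (M.extMap f).gal
    rw [hext]; exact ⟨hφ.gal_injective, fun x => ⟨x, rfl⟩⟩
  -- `C = false` is semi-elliptic as typed
  have hsemi : M.IsSemiElliptic false :=
    ⟨Bool.false_ne_true, true, f, hover, ⟨rfl, rfl, rfl⟩, hdeg⟩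
  -- the Galois correspondence: every (open) subgroup is a `Π_D`
  have hcov : ∀ (C : M.Curve) (J : Subgroup (M.ext C).arith), IsOpen (J : Set (M.ext C).arith) →
      ∃ (D : M.Curve) (f : M.FinEt D C), M.arithImage f = J := by
    intro C J _
    cases C with
    | true =>
      refine ⟨true, ⟨Or.inr rfl⟩, ?_⟩
      rw [htop₁ J]; exact hid₁
    | false =>
      rcases hsub₂ J with h | h
      · rw [h]; exact ⟨true, f, hJ⟩
      · rw [h]; exact ⟨false, ⟨Or.inr rfl⟩, hid₂⟩
  -- [AbsTopI] Lemma 4.1 (iv): schemes = torsion-free `Δ`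
  have h41 : ∀ X : M.Curve, M.IsScheme X ↔ ∀ g : ↥(M.ext X).geom, IsOfFinOrder g → g = 1 := by
    intro X
    cases X with
    | true => exact iff_of_true rfl htf₁
    | false => exact iff_of_false Bool.false_ne_true hntf₂
  -- Remark 3.1.1: the only scheme is `true`, of type `(1, 1)`
  have h311 : ∀ C : M.Curve, M.IsSemiElliptic C → ∀ (D : M.Curve) (f : M.FinEt D C), M.IsOver f →
      M.degree f = 2 → M.IsScheme D → M.IsOncePuncturedElliptic D := by
    intro C _ D g _ _ hD
    cases D with
    | false => exact absurd hD Bool.false_ne_true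
    | true => exact ⟨rfl, rfl, rfl⟩
  exact ⟨M, hcov, h41, h311, ⟨false, hsemi⟩,
    M.cor_3_3_iiTF_of_lem41iv_rmk311 (fun C J hJ' _ => hcov C J hJ') h41 h311⟩

end Literature.AnabelianGeometry.AbsoluteAnabelian.AbsTopII
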